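import Summits.NavierStokesRegularity.NavierStokesRegularity.Theorems.ExtremiserTransienceKStarAttainedHalfSpaceVariation
import HarnessLib

/-!
# Route `ExtremiserTransience`, support item `KStarAttained` (stmt-NavierStokesRegularity-24370):
# THE TOP-SPEED SET OF A SMOOTH ATTAINER OF `κ⋆` SURROUNDS THE ORIGIN — (2/4) the kernel-checked composition `topSpeedSurroundsOrigin_of` and the explicit wide-field family

Part of a 4-file plate (≤ 400 lines each, `lint.statement-form`) prepared by cell seat `nsreg-p3 g21` from
`HOME/ns-regularity-ideate-p3/round-26/Law26U.lean` (a08432649975ded6); the mathematics, mechanism and the main theorem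
`halfSpaceFree_of_attained` are described in the module docstring of file (4/4) `ExtremiserTransienceKStarAttainedHalfSpaceMain`.
Intended landing by a PROVER seat: `--supports stmt-NavierStokesRegularity-24370 --as helper`, files in order 1→4.
-/

noncomputable section

open Set Filter Topology MeasureTheory Metric
open scoped InnerProductSpace RealInnerProductSpace ENNReal NNReal ContDiff
open Literature.Analysis.FluidPDE
open Summit.NavierStokesRegularity.NavierStokesRegularity.Theorems
open Summit.NavierStokesRegularity.NavierStokesRegularity.Theorems.DepletionLadder.KStar

namespace Summit.NavierStokesRegularity.NavierStokesRegularity.Theorems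

-- the problem directory repeats the summit name (`NavierStokesRegularity/NavierStokesRegularity`)
set_option linter.dupNamespace false

namespace DepletionLadder.KStar.HalfSpace

variable {v φ : E3 → E3}

set_option maxHeartbeats 800000 in
/-- **The composition (kernel-checked): A ∧ B ⇒ the law.**  Suppose all top-speed velocities have `⟪v, t⟫ < 0`.
B gives a margin `(η, γ, R₁)`; A gives, for `θ > 0` as small as we please, a wide field `φ` equal to `t` on a ball
containing `{‖v‖ ≥ M − η}` with `|J₁|, |a₁|, |c₁| ≤ θ`.  Then `‖v + εφ‖ ≤ (1 − γε/(2M²))·M` for `0 ≤ ε < ε₀`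
(near the contact set `‖v + εt‖² ≤ M² − 2γε + ε²‖t‖² ≤ M² − γε`; elsewhere `‖v‖ < M − η` absorbs `ε‖φ‖ ≤ εC`,
`C = sup ‖φ‖ < ∞` by compact support),
so `firstVariation_le_of_oneSided_normBound` with `m = −γ/(2M²)` yields
`−|J|θ ≤ J·J₁ ≤ −κ⋆²γZW/2 + κ⋆²M²(W + Z)θ`, i.e. `κ⋆²γZW/2 ≤ θ·(|J| + κ⋆²M²(W+Z))`, false for small `θ`. -/
theorem topSpeedSurroundsOrigin_of (hA : WideFieldVanishing) (hBm : HalfSpaceMargin) :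
    TopSpeedSurroundsOrigin := by
  intro v M B hv hdiv hM hB h0 h1 h2 hpos hatt t
  by_contra hcon
  push Not at hcon
  have hZ0 : 0 ≤ Zen v := integral_nonneg fun x => sq_nonneg _
  have hW0 : 0 ≤ Wpa v := integral_nonneg fun x => frobeniusNormSq_nonneg _
  have hsZ : 0 ≤ Real.sqrt (Zen v) := Real.sqrt_nonneg _
  have hsW : 0 ≤ Real.sqrt (Wpa v) := Real.sqrt_nonneg _
  have hMpos : 0 < M := by
    rcases le_or_gt M 0 with hle | h
    · have : M * Real.sqrt (Zen v) * Real.sqrt (Wpa v) ≤ 0 :=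
        mul_nonpos_of_nonpos_of_nonneg (mul_nonpos_of_nonpos_of_nonneg hle hsZ) hsW
      linarith
    · exact h
  have hMne : M ≠ 0 := hMpos.ne'
  have hsZpos : 0 < Real.sqrt (Zen v) := by
    rcases hsZ.eq_or_lt with h | h
    · exfalso; rw [← h] at hpos; simp at hpos
    · exact h
  have hsWpos : 0 < Real.sqrt (Wpa v) := by
    rcases hsW.eq_or_lt with h | h
    · exfalso; rw [← h] at hpos; simp at hpos
    · exact h
  have hZpos : 0 < Zen v := Real.sqrt_pos.1 hsZpos
  have hWpos : 0 < Wpa v := Real.sqrt_pos.1 hsWpos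
  have hK : 0 < kStar := kStar_pos
  -- B: the margin
  obtain ⟨η, γ, R₁, hη, hγ, hfar, hmar⟩ := hBm v M B hv hM hB h0 hMpos t hcon
  have hγne : γ ≠ 0 := hγ.ne'
  -- A: a wide field with tiny first-variation coefficients
  set X : ℝ := |Jst v| + kStar ^ 2 * M ^ 2 * (Wpa v + Zen v) with hX
  have hX0 : 0 ≤ X := by positivity
  set P : ℝ := kStar ^ 2 * γ * Zen v * Wpa v with hP
  have hPpos : 0 < P := by positivity
  have hX1 : 0 < X + 1 := by linarith
  set θ : ℝ := P / 4 / (X + 1) with hθ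
  have hθpos : 0 < θ := by positivity
  obtain ⟨L, hL, φ, hφs, hφc, hφd, hφball, hJ1, hA1, hC1⟩ :=
    hA v M B hv hdiv hM hB h0 h1 h2 t θ hθpos R₁
  obtain ⟨C, hC⟩ := hφs.continuous.bounded_above_of_compact_support hφc
  have hC0 : 0 ≤ C := (norm_nonneg _).trans (hC 0)
  -- the one-sided norm bound with `m = -γ/(2M²)`
  set m : ℝ := -(γ / (2 * M ^ 2)) with hm
  have hd1 : 0 < C + γ / (2 * M) + 1 := by positivity
  have hd2 : 0 < 16 * ‖t‖ ^ 2 + 1 := by positivity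
  set ε₀ : ℝ := min (η / (C + γ / (2 * M) + 1)) (min (γ / (16 * ‖t‖ ^ 2 + 1)) (M ^ 2 / γ)) with hε₀
  have hε₀pos : 0 < ε₀ := lt_min (div_pos hη hd1) (lt_min (div_pos hγ hd2) (div_pos (pow_pos hMpos 2) hγ))
  have hbound : ∀ ε : ℝ, 0 ≤ ε → ε < ε₀ → ∀ x, ‖v x + ε • φ x‖ ≤ (1 + m * ε) * M := by
    intro ε hε hεlt x
    have hε1 : ε ≤ η / (C + γ / (2 * M) + 1) := hεlt.le.trans (min_le_left _ _)
    have hε2 : ε ≤ γ / (16 * ‖t‖ ^ 2 + 1) := hεlt.le.trans ((min_le_right _ _).trans (min_le_left _ _))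
    have hε3 : ε ≤ M ^ 2 / γ := hεlt.le.trans ((min_le_right _ _).trans (min_le_right _ _))
    have hε1' : ε * (C + γ / (2 * M) + 1) ≤ η := (le_div_iff₀ hd1).1 hε1
    have hε2' : ε * (16 * ‖t‖ ^ 2 + 1) ≤ γ := (le_div_iff₀ hd2).1 hε2
    have hε3' : ε * γ ≤ M ^ 2 := (le_div_iff₀ hγ).1 hε3
    have hmε : (1 + m * ε) * M = M - ε * γ / (2 * M) := by rw [hm]; field_simp; ring
    have hR : 0 ≤ (1 + m * ε) * M := by
      rw [hmε]
      have h' : ε * γ / (2 * M) ≤ M / 2 := by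
        rw [div_le_iff₀ (by positivity)]
        have : M / 2 * (2 * M) = M ^ 2 := by ring
        linarith
      linarith
    by_cases hx : M - η ≤ ‖v x‖
    · -- near the contact set: `φ x = t`, `⟪v x, t⟫ ≤ -γ`
      have hxL : ‖x‖ < L := lt_of_lt_of_le (hfar x hx) hL
      rw [hφball x hxL]
      have hin : ⟪v x, t⟫_ℝ ≤ -γ := hmar x hx
      have hin' : ε * ⟪v x, t⟫_ℝ ≤ ε * (-γ) := mul_le_mul_of_nonneg_left hin hε
      have hvx : ‖v x‖ ^ 2 ≤ M ^ 2 := pow_le_pow_left₀ (norm_nonneg _) (hM x) 2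
      have ht1 : ε * ‖t‖ ^ 2 ≤ γ := by
        have h' : ε * ‖t‖ ^ 2 ≤ ε * (16 * ‖t‖ ^ 2 + 1) :=
          mul_le_mul_of_nonneg_left (by nlinarith [sq_nonneg ‖t‖]) hε
        linarith
      have ht2 : ε ^ 2 * ‖t‖ ^ 2 ≤ ε * γ := by
        have h' : ε ^ 2 * ‖t‖ ^ 2 = ε * (ε * ‖t‖ ^ 2) := by ring
        rw [h']
        exact mul_le_mul_of_nonneg_left ht1 hε
      have hsq : ‖v x + ε • t‖ ^ 2 ≤ ((1 + m * ε) * M) ^ 2 := by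
        rw [norm_add_smul_sq_expand, hmε]
        have hexp : (M - ε * γ / (2 * M)) ^ 2 = M ^ 2 - ε * γ + (ε * γ / (2 * M)) ^ 2 := by
          field_simp; ring
        rw [hexp]
        linarith [sq_nonneg (ε * γ / (2 * M))]
      have hroot := Real.sqrt_le_sqrt hsq
      rwa [Real.sqrt_sq (norm_nonneg _), Real.sqrt_sq hR] at hroot
    · -- away from the contact set: `‖v x‖ < M - η` absorbs `ε‖φ x‖ ≤ εC`
      have hx' : ‖v x‖ < M - η := not_le.1 hx
      calc ‖v x + ε • φ x‖ ≤ ‖v x‖ + ‖ε • φ x‖ := norm_add_le _ _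
        _ = ‖v x‖ + ε * ‖φ x‖ := by rw [norm_smul, Real.norm_eq_abs, abs_of_nonneg hε]
        _ ≤ (M - η) + ε * C := by
            have := mul_le_mul_of_nonneg_left (hC x) hε
            linarith
        _ ≤ (1 + m * ε) * M := by
            rw [hmε]
            have h' : ε * (C + γ / (2 * M)) ≤ ε * (C + γ / (2 * M) + 1) :=
              mul_le_mul_of_nonneg_left (by linarith) hε
            have h'' : ε * (C + γ / (2 * M)) = ε * C + ε * γ / (2 * M) := by ring
            linarith
  -- the one-sided first variation
  have hfv := firstVariation_le_of_oneSided_normBound hv hdiv hB h0 h1 h2 hatt hφs hφc hφd hε₀pos hbound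
  -- bookkeeping to a contradiction
  have hj : -(|Jst v| * θ) ≤ Jst v * J1 v φ := by
    have habs : |Jst v * J1 v φ| ≤ |Jst v| * θ := by
      rw [abs_mul]; exact mul_le_mul_of_nonneg_left hJ1 (abs_nonneg _)
    exact (abs_le.1 habs).1
  have ha : Wpa v * A1 v φ ≤ Wpa v * θ := mul_le_mul_of_nonneg_left (le_of_abs_le hA1) hW0
  have hc : Zen v * C1 v φ ≤ Zen v * θ := mul_le_mul_of_nonneg_left (le_of_abs_le hC1) hZ0
  have hmZW : kStar ^ 2 * M ^ 2 * (m * Zen v * Wpa v) = -(P / 2) := by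
    rw [hm, hP]; field_simp
  have hθX : θ * (X + 1) = P / 4 := by rw [hθ]; field_simp
  have hK2M2 : 0 ≤ kStar ^ 2 * M ^ 2 := by positivity
  have hsum : kStar ^ 2 * M ^ 2 * (m * Zen v * Wpa v + Wpa v * A1 v φ + Zen v * C1 v φ) ≤
      -(P / 2) + kStar ^ 2 * M ^ 2 * (Wpa v * θ + Zen v * θ) := by
    rw [mul_add, mul_add, hmZW, mul_add]
    have h1' := mul_le_mul_of_nonneg_left ha hK2M2
    have h2' := mul_le_mul_of_nonneg_left hc hK2M2
    linarith
  have hθX' : θ * X ≤ P / 4 := by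
    have h' : θ * X = θ * (X + 1) - θ := by ring
    linarith [hθpos.le]
  have hXθ : |Jst v| * θ + kStar ^ 2 * M ^ 2 * (Wpa v * θ + Zen v * θ) = θ * X := by rw [hX]; ring
  linarith [hfv, hsum, hj, hXθ, hθX', hPpos]

/-- **The law from input A alone** (B is proved): `WideFieldVanishing → TopSpeedSurroundsOrigin`. -/
theorem topSpeedSurroundsOrigin_of_wideField (hA : WideFieldVanishing) : TopSpeedSurroundsOrigin :=
  topSpeedSurroundsOrigin_of hA halfSpaceMargin_holds

/-! ## 4. The explicit wide-field family; input A reduced to a pure estimate -/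

/-- The bump `χ_L`: plateau radius `max L 1`, outer radius `2 · max L 1` (Mathlib `ContDiffBump`, so
`χ_L (x) = χ₁ (x / max L 1)` by construction and `‖D^k χ_L‖_∞ = O(L^{-k})`). -/
def bumpL (L : ℝ) : ContDiffBump (0 : E3) :=
  ⟨max L 1, 2 * max L 1, lt_of_lt_of_le one_pos (le_max_right _ _), by
    have : 0 < max L 1 := lt_of_lt_of_le one_pos (le_max_right _ _)
    linarith⟩

/-- **The wide field** `φ_L = wideField t L = curl (χ_L · ½ t × x)`. -/
def wideField (t : E3) (L : ℝ) : E3 → E3 :=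
  curl fun y => (bumpL L) y • ((1 / 2 : ℝ) • crossCLM t y)

/-- `curl (½ t × x) = t` (solid-body rotation; tree `curlCLM_crossCLM`). [folklore] -/
theorem curl_half_cross (t x : E3) : curl (fun y => (1 / 2 : ℝ) • crossCLM t y) x = t := by
  rw [curl_eq_curlCLM]
  have h : HasFDerivAt (fun y => (1 / 2 : ℝ) • crossCLM t y) ((1 / 2 : ℝ) • crossCLM t) x :=
    ((crossCLM t).hasFDerivAt).const_smul (1 / 2 : ℝ)
  rw [h.fderiv, map_smul, curlCLM_crossCLM, smul_smul]
  norm_num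

/-- **Qualitative properties of the wide field (PROVED):** `φ_L` is `C^∞`, compactly supported, divergence free,
and equals `t` on the ball `‖x‖ < L` (Leibniz rule `curl (χ ψ) = χ curl ψ + ∇χ × ψ` with `curl ψ = t`, `χ = 1`,
`∇χ = 0` on the plateau; same pattern as the tree's `KStar.cutoff_field`). [folklore] -/
theorem wideField_props (t : E3) (L : ℝ) :
    ContDiff ℝ ∞ (wideField t L) ∧ HasCompactSupport (wideField t L) ∧
      VectorCalculus.IsDivFree (wideField t L) ∧ ∀ x : E3, ‖x‖ < L → wideField t L x = t := by
  have hA : ContDiff ℝ ∞ fun y : E3 => (1 / 2 : ℝ) • crossCLM t y := (crossCLM t).contDiff.const_smul _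
  have hη : ContDiff ℝ ∞ fun y => (bumpL L) y • ((1 / 2 : ℝ) • crossCLM t y) :=
    (bumpL L).contDiff.smul hA
  have hcurl : ContDiff ℝ ∞ (wideField t L) := by
    unfold wideField
    rw [curl_eq_curlCLM_comp]
    exact curlCLM.contDiff.comp (hη.fderiv_right (m := ∞) le_rfl)
  refine ⟨hcurl, hasCompactSupport_curl (bumpL L).hasCompactSupport.smul_right,
    fun x => divergence_curl_eq_zero_holds _ (hη.of_le (by norm_cast)) x, fun x hx => ?_⟩
  have hxin : x ∈ ball (0 : E3) (bumpL L).rIn := by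
    rw [mem_ball, dist_zero_right]
    exact lt_of_lt_of_le hx (le_max_left _ _)
  unfold wideField
  rw [curl_smul (((bumpL L).contDiff (n := 1)).differentiable one_ne_zero x) (hA.differentiable (by simp) x),
    curl_half_cross, fderiv_bump_eq_zero_of_mem_ball (bumpL L) hxin,
    (bumpL L).one_of_mem_closedBall (ball_subset_closedBall hxin)]
  simp

/-- **Analytic input A′ — the residual pure ESTIMATE (paper proof ROUND-26 §2(A)).** For admissible `v`, every
`t`, `θ > 0`, `L₀`: some `L ≥ L₀` has `|J₁(φ_L)|, |a₁(φ_L)|, |c₁(φ_L)| ≤ θ` for the explicit `φ_L = wideField t L`.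
Paper: `χ_L·(½ t × x) = max(L,1) · Ψ₁(x / max(L,1))` with `Ψ₁ = χ₁ · ½ t × x ∈ C^∞_c(B₂)`, so
`‖D^k(χ_L · ½ t × x)‖_∞ ≤ C_k(t) L^{1-k}`; hence `‖Dφ_L‖_∞, ‖curl φ_L‖_∞ = O(1/L)`, `‖D curl φ_L‖_∞, ‖curl curl φ_L‖_∞
= O(1/L²)`, all supported in `B_{2L}`, `|B_{2L}|^{1/2} = O(L^{3/2})`:  `|J₁| ≤ O(1/L)·(2‖Dv‖₂‖ω‖₂ + ‖ω‖₂²)`,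
`|a₁| = |∫⟪v, curl curl φ_L⟫| ≤ O(L^{-1/2})‖v‖₂` (one integration by parts — needed: the direct bound is `O(L^{1/2})`),
`|c₁| ≤ O(L^{-1/2})‖∇ω‖₂`. -/
def WideFieldEstimates : Prop :=
  ∀ (v : E3 → E3) (M B : ℝ), ContDiff ℝ ∞ v → VectorCalculus.IsDivFree v → (∀ x, ‖v x‖ ≤ M) →
    (∀ x, ‖fderiv ℝ v x‖ ≤ B) → (∫⁻ x, ‖iteratedFDeriv ℝ 0 v x‖ₑ ^ 2 < ⊤) →
    (∫⁻ x, ‖iteratedFDeriv ℝ 1 v x‖ₑ ^ 2 < ⊤) → (∫⁻ x, ‖iteratedFDeriv ℝ 2 v x‖ₑ ^ 2 < ⊤) →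
    ∀ (t : E3) (θ : ℝ), 0 < θ → ∀ L₀ : ℝ, ∃ L : ℝ, L₀ ≤ L ∧
      |J1 v (wideField t L)| ≤ θ ∧ |A1 v (wideField t L)| ≤ θ ∧ |C1 v (wideField t L)| ≤ θ

/-- **A′ ⇒ A** (the explicit family witnesses input A). -/
theorem wideFieldVanishing_of_estimates (h : WideFieldEstimates) : WideFieldVanishing := by
  intro v M B hv hdiv hM hB h0 h1 h2 t θ hθ L₀
  obtain ⟨L, hL, hJ, hA, hC⟩ := h v M B hv hdiv hM hB h0 h1 h2 t θ hθ L₀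
  obtain ⟨hs, hc, hd, hball⟩ := wideField_props t L
  exact ⟨L, hL, wideField t L, hs, hc, hd, hball, hJ, hA, hC⟩

/-- **THE LAW from the single residual estimate A′:** `WideFieldEstimates → TopSpeedSurroundsOrigin`
(everything else — one-sided variation, margin, construction of the wide field — is kernel-checked above). -/
theorem topSpeedSurroundsOrigin_of_estimates (h : WideFieldEstimates) : TopSpeedSurroundsOrigin :=
  topSpeedSurroundsOrigin_of_wideField (wideFieldVanishing_of_estimates h)

end DepletionLadder.KStar.HalfSpace

end Summit.NavierStokesRegularity.NavierStokesRegularity.Theorems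

end
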